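import Summits.HubbardSuperconductivity.HubbardSuperconductivity.Theorems.AnisotropyChordTransferFibre3RowCDrops
import Summits.HubbardSuperconductivity.HubbardSuperconductivity.Theorems.AnisotropyChordTransferFibre3Cs2Rows

/-!
# Route `AnisotropyChord` / H0 rotor rung: PartN41-C §2 — `XmomNamed` PROVED (`X` named through `τₓ(K₁)`)

Theory-1 g22's PartN41-C §2 `XmomNamed` (port …Fibre3KT2bRow): the `K₁` phase-defect moment of the regular weight,
`X = Σ_a R(a)(1 − cos θ(aₓ − 1))`, is NAMED: ★ `X = R̄ − Re(e^{iθ} τₓ(K₁)) + η_eff²(1 + cos θ)` with `τₓ(K₁) = FT[(∇ₓs)²](K₁)`,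
because `Re(e^{iθ} e^{−iθ aₓ}) = cos θ(aₓ − 1)` (★ `re_phase_K1_mul_conj`) and the two contact sites removed from `R` carry
`(∇ₓs(0))² = (∇ₓs(x̂))² = η_eff²` at phases `cos θ` and `1` (`RowC.gradx_s_zero`, `RowC.gradx_s_K1`).
★ `RowC.xmom_named`, ★ `xmomNamed_holds (Δ) : XmomNamed L Δ`.
Prover seat `hubbard-h0-rotor-p1` g27 (route lead); helper for stmt-HubbardSuperconductivity-23918 (`--supports`, helper class).
WHAT THIS IS NOT: nothing here proves superconductivity in the Hubbard model; a closed form of one input of ONE row of ONE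
conditional reduction.  Tree imports only; no new definitions; no sorry, no axioms.
-/

set_option linter.dupNamespace false
set_option autoImplicit false

noncomputable section

open scoped BigOperators

namespace Summit.HubbardSuperconductivity.HubbardSuperconductivity.Theorems.AnisotropyChord.Transfer.Fibre3

variable (L : ℕ) [NeZero L]

namespace RowC

/-- `e^{iθ}·conj(e^{iθ aₓ}) = exp(−i·θ(aₓ − 1))` (`L ≥ 2`). [folklore] -/
theorem phase_K1_mul_conj (hL : 2 ≤ L) (a : Tor L) :
    phase L (K1 L) (K1 L) * (starRingEnd ℂ) (phase L (K1 L) a)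
      = Complex.exp (-(((2 * Real.pi * ((a.1.val : ℝ) - 1) / L : ℝ) : ℂ) * Complex.I)) := by
  have : Fact (1 < L) := ⟨by omega⟩
  set x : ℝ := 2 * Real.pi * ((a.1.val : ℝ) - 1) / L with hx
  -- as in `normSq_alphaT`: `phase K₁ a · phase K₁ (−K₁) = exp(i x)`
  have h2 : phase L (K1 L) a * phase L (K1 L) (-(K1 L)) = Complex.exp ((x : ℂ) * Complex.I) := by
    rw [← conj_phase, phase_comm L (K1 L) a, show phase L a (K1 L) = phase L a (ex L) from rfl, phase_ex,
      show phase L (K1 L) (K1 L) = phase L (K1 L) (ex L) from rfl, phase_ex, ← Complex.exp_conj, ← Complex.exp_add]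
    congr 1
    have hv : ((K1 L).1.val : ℕ) = 1 := by unfold K1; exact ZMod.val_one L
    rw [hv, hx]
    simp only [map_mul, map_div₀, Complex.conj_ofReal, Complex.conj_I, map_natCast, map_ofNat, Nat.cast_one, map_one]
    push_cast
    ring
  have h3 : phase L (K1 L) (K1 L) * (starRingEnd ℂ) (phase L (K1 L) a)
      = (starRingEnd ℂ) (phase L (K1 L) a * phase L (K1 L) (-(K1 L))) := by
    rw [map_mul, conj_phase L (K1 L) (-(K1 L)), neg_neg, mul_comm]
  rw [h3, h2, ← Complex.exp_conj, map_mul, Complex.conj_ofReal, Complex.conj_I]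
  congr 1
  ring

/-- `Re(e^{iθ} conj(e^{iθaₓ}) · g) = cos θ(aₓ − 1) · g` for real `g` (`L ≥ 2`). [folklore] -/
theorem re_phase_K1_mul_conj (hL : 2 ≤ L) (a : Tor L) (g : ℝ) :
    (phase L (K1 L) (K1 L) * (starRingEnd ℂ) (phase L (K1 L) a) * (g : ℂ)).re
      = Real.cos (2 * Real.pi * ((a.1.val : ℝ) - 1) / L) * g := by
  rw [phase_K1_mul_conj L hL a, Complex.re_mul_ofReal, ← neg_mul, ← Complex.ofReal_neg, Complex.exp_ofReal_mul_I_re,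
    Real.cos_neg]

/-- `Re(e^{iθ} τₓ(K₁)) = Σ_a cos θ(aₓ − 1)·(∇ₓs(a))²` (`L ≥ 2`). [folklore] -/
theorem re_phase_tauK1 (hL : 2 ≤ L) (Δ : ℝ) (f : Tor L → ℝ) :
    (phase L (K1 L) (K1 L) * tauK1 L Δ f).re
      = ∑ a : Tor L, Real.cos (2 * Real.pi * ((a.1.val : ℝ) - 1) / L) * gradx L (sfun L Δ f) a ^ 2 := by
  unfold tauK1 dft
  rw [Finset.mul_sum, Complex.re_sum]
  refine Finset.sum_congr rfl fun a _ => ?_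
  rw [← mul_assoc, Complex.ofReal_pow]
  have := re_phase_K1_mul_conj L hL a (gradx L (sfun L Δ f) a ^ 2)
  rw [Complex.ofReal_pow] at this
  exact this

/-- ★ `X = R̄ − Re(e^{iθ}τₓ(K₁)) + η_eff²(1 + cos θ)` (body of `XmomNamed L Δ`, `L ≥ 3`). [folklore] -/
theorem xmom_named (hL : 3 ≤ L) {Δ lam2 : ℝ} {f : Tor L → ℝ} (hf : IsTwoMagnon L Δ lam2 f) :
    Xmom L Δ f = Rbar L Δ f - (phase L (K1 L) (K1 L) * tauK1 L Δ f).re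
      + etaEff L lam2 ^ 2 * (1 + Real.cos (2 * Real.pi / L)) := by
  have : Fact (1 < L) := ⟨by omega⟩
  rw [re_phase_tauK1 L (by omega)]
  -- `X = R̄ − Σ R cos`
  have hX : Xmom L Δ f = Rbar L Δ f
      - ∑ a : Tor L, Rwt L Δ f a * Real.cos (2 * Real.pi * ((a.1.val : ℝ) - 1) / L) := by
    unfold Xmom Rbar
    rw [← Finset.sum_sub_distrib]
    refine Finset.sum_congr rfl fun a _ => ?_
    ring
  -- remove the two contact sites
  have hR : ∑ a : Tor L, Rwt L Δ f a * Real.cos (2 * Real.pi * ((a.1.val : ℝ) - 1) / L)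
      = (∑ a : Tor L, Real.cos (2 * Real.pi * ((a.1.val : ℝ) - 1) / L) * gradx L (sfun L Δ f) a ^ 2)
        - Real.cos (2 * Real.pi * (((0 : Tor L).1.val : ℝ) - 1) / L) * gradx L (sfun L Δ f) 0 ^ 2
        - Real.cos (2 * Real.pi * (((K1 L).1.val : ℝ) - 1) / L) * gradx L (sfun L Δ f) (K1 L) ^ 2 := by
    have e : ∀ a : Tor L, Rwt L Δ f a * Real.cos (2 * Real.pi * ((a.1.val : ℝ) - 1) / L)
        = Real.cos (2 * Real.pi * ((a.1.val : ℝ) - 1) / L) * gradx L (sfun L Δ f) a ^ 2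
          - (if a = 0 then Real.cos (2 * Real.pi * ((a.1.val : ℝ) - 1) / L) * gradx L (sfun L Δ f) a ^ 2 else 0)
          - (if a = K1 L then Real.cos (2 * Real.pi * ((a.1.val : ℝ) - 1) / L) * gradx L (sfun L Δ f) a ^ 2 else 0) := by
      intro a
      rw [Rwt_eq L (by omega) Δ f a]
      split_ifs <;> ring
    rw [Finset.sum_congr rfl fun a _ => e a, Finset.sum_sub_distrib, Finset.sum_sub_distrib,
      Finset.sum_ite_eq' Finset.univ (0 : Tor L), Finset.sum_ite_eq' Finset.univ (K1 L)]
    simp only [Finset.mem_univ, if_true]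
  have hv0 : (((0 : Tor L).1.val : ℕ) : ℝ) = 0 := by simp
  have hv1 : (((K1 L).1.val : ℕ) : ℝ) = 1 := by
    have : ((K1 L).1.val : ℕ) = 1 := by unfold K1; exact ZMod.val_one L
    rw [this]; simp
  rw [hX, hR, hv0, hv1, gradx_s_zero L hL hf, gradx_s_K1 L hL hf]
  have c0 : Real.cos (2 * Real.pi * ((0 : ℝ) - 1) / L) = Real.cos (2 * Real.pi / L) := by
    rw [← Real.cos_neg]; congr 1; ring
  have c1 : Real.cos (2 * Real.pi * ((1 : ℝ) - 1) / L) = 1 := by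
    rw [sub_self, mul_zero, zero_div, Real.cos_zero]
  rw [c0, c1]
  ring

end RowC

/-- ★ **`XmomNamed L Δ` holds.** [folklore] -/
theorem xmomNamed_holds (Δ : ℝ) : XmomNamed L Δ :=
  fun _ _ hL hf => RowC.xmom_named L hL hf.1

end Summit.HubbardSuperconductivity.HubbardSuperconductivity.Theorems.AnisotropyChord.Transfer.Fibre3

end
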